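import Mathlib
import Summits.Ventures.PercRepro2.K5K3Tables
import Summits.Ventures.PercRepro2.Inst8Conn

/-!
# THE TWELVE FUNCTIONS OF `K₃` ON AN INSTANCE GRAPH ARE THE TABLES OF `Inst8Kernel.lean`
(blind cell PercRepro2, typer-1 g14; `K5K3Tables.lean` for an instance graph `G : Inst`)

On `G` with the marks `(o, a₁, a₂, a₃, b) = (0, 1, 2, 3, b)` the twelve functions of p1's kernel `K₃`
(`HCovFns.lean`) are differences of the `0/1` tables of `Inst8Kernel.lean` through `Inst8Conn.conn_iff`;
on `Q` no vertex lies in both clusters (`conn12_of`), so each `f_i` is `f_i⁺ − f_i⁻` (the Boolean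
identities `K5.f3_bool`, …, `K5.f12_bool` of `K5K3Tables.lean`, which are graph-free).  Hence
**`K3_apply`**: `K₃ x y w` is the signed sum of the twenty products of tables of `kPos3 G b` / `kNeg3 G b`,
in the order `x, y, w`.  `Inst8TypedK3.lean` turns this into the typed-count identity and the kernel
theorem.
-/

namespace Summit.Ventures.PercRepro2

open Hub

namespace Inst8

section Tables

variable {R : Type*} [Field R]

/-- `1_{v∈C₁}` is the table `L_v`. -/
lemma iL_eq (G : Inst) (v : Fin 8) :
    (CovForm.iL (ends G) 1 v : Config (Fin 10) → R) = K5.indR (tL G v) :=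
  K5.indicator_eq_indR _ _ (tL_iff G v)

/-- `1_{v∈C₂}` is the table `H_v`. -/
lemma iH_eq (G : Inst) (v : Fin 8) :
    (CovForm.iH (ends G) 2 v : Config (Fin 10) → R) = K5.indR (tH G v) :=
  K5.indicator_eq_indR _ _ (tH_iff G v)

/-- `1_Q` is the table `tQ`. -/
lemma iQ_eq3 (G : Inst) : (CovForm.iQ (ends G) 1 2 : Config (Fin 10) → R) = K5.indR (tQ G) :=
  K5.indicator_eq_indR _ _ (tQ_iff G)

/-- `1_PD` is the table `tPD`. -/
lemma iPD_eq3 (G : Inst) : (CovForm.iPD (ends G) 1 2 3 : Config (Fin 10) → R) = K5.indR (tPD G) :=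
  K5.indicator_eq_indR _ _ (tPD_iff G)

/-- `((3 : Fin 8) : ℕ) = 3`. -/
lemma val3 : ((3 : Fin 8) : ℕ) = 3 := rfl

/-- `f₃ = 1_PD 1_{o∈U}` is the table `tPDoU`. -/
lemma f3_eq (G : Inst) :
    (CovForm.f3 (ends G) 0 1 2 3 : Config (Fin 10) → R) = K5.indR (tPDoU G) := by
  funext ω
  unfold CovForm.f3 CovForm.inU
  rw [iPD_eq3, iL_eq, iH_eq]
  unfold K5.indR tPDoU tPD tQ tL tH
  exact K5.f3_bool _ _ _ _ _ (conn12_of G ω 0)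

/-- `f₄ = 1_Q σ_o σ_b` is `t4p − t4m`. -/
lemma f4_eq (G : Inst) (b : Fin 8) :
    (CovForm.f4 (ends G) 0 1 2 b : Config (Fin 10) → R) =
      fun ω => K5.indR (t4p G b) ω - K5.indR (t4m G b) ω := by
  funext ω
  unfold CovForm.f4 CovForm.sigma
  rw [iQ_eq3, iL_eq, iH_eq, iL_eq, iH_eq]
  unfold K5.indR t4p t4m tSame tOpp tQ tL tH
  exact K5.f4_bool _ _ _ _ _ (conn12_of G ω 0) (conn12_of G ω b)

/-- `f₅ = 1_Q σ₃ σ_b` is `t5p − t5m`. -/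
lemma f5_eq (G : Inst) (b : Fin 8) :
    (CovForm.f5 (ends G) 1 2 3 b : Config (Fin 10) → R) =
      fun ω => K5.indR (t5p G b) ω - K5.indR (t5m G b) ω := by
  funext ω
  unfold CovForm.f5 CovForm.sigma
  rw [iQ_eq3, iL_eq, iH_eq, iL_eq, iH_eq]
  unfold K5.indR t5p t5m tSame tOpp tQ tL tH
  exact K5.f4_bool _ _ _ _ _ (conn12_of G ω 3) (conn12_of G ω b)

/-- `f₆ = 1_Q σ₃ 1_{o∈U} σ_b` is `t6p − t6m`. -/
lemma f6_eq (G : Inst) (b : Fin 8) :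
    (CovForm.f6 (ends G) 0 1 2 3 b : Config (Fin 10) → R) =
      fun ω => K5.indR (t6p G b) ω - K5.indR (t6m G b) ω := by
  funext ω
  unfold CovForm.f6 CovForm.sigma CovForm.inU
  rw [iQ_eq3, iL_eq, iH_eq, iL_eq, iH_eq, iL_eq, iH_eq]
  unfold K5.indR t6p t6m tSame tOpp tU tQ tL tH
  exact K5.f6_bool _ _ _ _ _ _ _ (conn12_of G ω 3) (conn12_of G ω 0) (conn12_of G ω b)

/-- `f₇ = 1_Q σ_v` is `t7p v − t7m v`. -/
lemma f7_eq (G : Inst) (v : Fin 8) :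
    (CovForm.f7 (ends G) 1 2 v : Config (Fin 10) → R) =
      fun ω => K5.indR (t7p G v) ω - K5.indR (t7m G v) ω := by
  funext ω
  unfold CovForm.f7 CovForm.sigma
  rw [iQ_eq3, iL_eq, iH_eq]
  unfold K5.indR t7p t7m tQ tL tH
  exact K5.f7_bool _ _ _ (conn12_of G ω v)

/-- `f₁₀ = 1_Q σ₃ 1_{o∈U}` is `t10p − t10m`. -/
lemma f10_eq (G : Inst) :
    (CovForm.f10 (ends G) 0 1 2 3 : Config (Fin 10) → R) =
      fun ω => K5.indR (t10p G) ω - K5.indR (t10m G) ω := by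
  funext ω
  unfold CovForm.f10 CovForm.sigma CovForm.inU
  rw [iQ_eq3, iL_eq, iH_eq, iL_eq, iH_eq]
  unfold K5.indR t10p t10m tU tQ tL tH
  exact K5.f10_bool _ _ _ _ _ (conn12_of G ω 3) (conn12_of G ω 0)

/-- `f₁₁ = 1_PD 1_{o∈U} 1_{b∈U}` is the table `t11`. -/
lemma f11_eq (G : Inst) (b : Fin 8) :
    (CovForm.f11 (ends G) 0 1 2 3 b : Config (Fin 10) → R) = K5.indR (t11 G b) := by
  funext ω
  unfold CovForm.f11 CovForm.inU
  rw [iPD_eq3, iL_eq, iH_eq, iL_eq, iH_eq]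
  unfold K5.indR t11 tU tPD tQ tL tH
  exact K5.f11_bool _ _ _ _ _ _ _ (conn12_of G ω 0) (conn12_of G ω b)

/-- `f₁₂ = 1_PD 1_{b∈U}` is the table `t12`. -/
lemma f12_eq (G : Inst) (b : Fin 8) :
    (CovForm.f12 (ends G) 1 2 3 b : Config (Fin 10) → R) = K5.indR (t12 G b) := by
  funext ω
  unfold CovForm.f12 CovForm.inU
  rw [iPD_eq3, iL_eq, iH_eq]
  unfold K5.indR t12 tU tPD tQ tL tH
  exact K5.f12_bool _ _ _ _ _ (conn12_of G ω b)

/-- **The kernel `K₃` on an instance graph is the signed sum of twenty products of tables** (the ten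
positive products of `kPos3`, then the ten negative products of `kNeg3`, in the order `x, y, w`). -/
lemma K3_apply (G : Inst) (b : Fin 8) (x y w : Config (Fin 10)) :
    CovForm.K3 (R := R) (ends G) 0 1 2 3 b x y w =
      (K5.indR (tPD G) x * K5.indR (tQ G) y * K5.indR (t4p G b) w +
        K5.indR (tQ G) x * K5.indR (tPDoU G) y * K5.indR (t5p G b) w +
        K5.indR (tPD G) x * K5.indR (tQ G) y * K5.indR (t6m G b) w +
        K5.indR (tPD G) x * K5.indR (t7p G b) y * K5.indR (t7m G 0) w +
        K5.indR (tPD G) x * K5.indR (t7m G b) y * K5.indR (t7p G 0) w +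
        K5.indR (tPDoU G) x * K5.indR (t7p G b) y * K5.indR (t7m G 3) w +
        K5.indR (tPDoU G) x * K5.indR (t7m G b) y * K5.indR (t7p G 3) w +
        K5.indR (tPD G) x * K5.indR (t7p G b) y * K5.indR (t10p G) w +
        K5.indR (tPD G) x * K5.indR (t7m G b) y * K5.indR (t10m G) w +
        K5.indR (tQ G) x * K5.indR (t12 G b) y * K5.indR (tPDoU G) w) -
      (K5.indR (tPD G) x * K5.indR (tQ G) y * K5.indR (t4m G b) w +
        K5.indR (tQ G) x * K5.indR (tPDoU G) y * K5.indR (t5m G b) w +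
        K5.indR (tPD G) x * K5.indR (tQ G) y * K5.indR (t6p G b) w +
        K5.indR (tPD G) x * K5.indR (t7p G b) y * K5.indR (t7p G 0) w +
        K5.indR (tPD G) x * K5.indR (t7m G b) y * K5.indR (t7m G 0) w +
        K5.indR (tPDoU G) x * K5.indR (t7p G b) y * K5.indR (t7p G 3) w +
        K5.indR (tPDoU G) x * K5.indR (t7m G b) y * K5.indR (t7m G 3) w +
        K5.indR (tPD G) x * K5.indR (t7p G b) y * K5.indR (t10m G) w +
        K5.indR (tPD G) x * K5.indR (t7m G b) y * K5.indR (t10p G) w +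
        K5.indR (tPD G) x * K5.indR (tQ G) y * K5.indR (t11 G b) w) := by
  unfold CovForm.K3 CovForm.sepKernel
  simp only [Fin.sum_univ_succ, Fin.sum_univ_zero, Matrix.cons_val_zero, Matrix.cons_val_succ,
    add_zero]
  rw [iPD_eq3, iQ_eq3, f3_eq, f4_eq, f5_eq, f6_eq, f7_eq, f7_eq, f7_eq, f10_eq, f11_eq, f12_eq]
  simp only [val3, Fin.val_zero]
  ring

end Tables

end Inst8

end Summit.Ventures.PercRepro2
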